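import Summits.Langlands.Langlands.Theses.OrdinaryPrimeTransport
import Summits.Langlands.Langlands.Theorems.IrreducibilityBySelfDualityReciprocityUpToIrreducibilityCorrespondsConj
import HarnessLib
set_option linter.dupNamespace false

/-!
# `OrdinaryPrimeTransport.IrreducibleAvatarsConjugate` (stmt-Langlands-17318) — closed BY NAME

Leaf proof twin (decomp-langlands lens-2 g25, freeze currency): the crux item
`Summit.Langlands.Langlands.Theses.OrdinaryPrimeTransport.IrreducibleAvatarsConjugate` (two irreducible framed
`ℓ`-adic representations both Satake–Frobenius compatible with the same cuspidal `π` at almost all places are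
`GL_n(ℚ̄_ℓ)`-conjugate) is exactly the landed theorem
`Summit.Langlands.Langlands.Theorems.ReciprocityUpToIrreducibility.isConjugate_of_satakeFrobCompatibleAt`
(`Theorems/IrreducibilityBySelfDualityReciprocityUpToIrreducibilityCorrespondsConj.lean`: Satake-parameter uniqueness
⇒ equal Frobenius characteristic polynomials a.e. ⇒ Chebotarev density ⇒ Brauer–Nesbitt ⇒ `FramedRep.exists_eq_conj_of_equiv`).
HAZARD recorded on the item: this proof's import cone contains the Chebotarev / `LAdicRepFrobenius` facts the route
`OrdinaryPrimeTransport` keeps out of its `closes` cone — that is WHY the item exists (cone discipline); landing this file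
under `Theorems/` does not touch the route file's imports.
Refs: Deligne–Serre (1974) Lemme 3.2; Serre, *Abelian ℓ-adic representations* I §2.3. [cite: DeligneSerreASENS1974, Lemme 3.2]
-/

namespace Summit.Langlands.Langlands.Theorems

/-- stmt-Langlands-17318 holds: irreducible avatars of the same cuspidal `π` are conjugate.
[cite: DeligneSerreASENS1974, Lemme 3.2] -/
theorem OrdinaryPrimeTransport.irreducibleAvatarsConjugate_holds :
    Summit.Langlands.Langlands.Theses.OrdinaryPrimeTransport.IrreducibleAvatarsConjugate := by
  intro n F _ _ hcpt π ℓ _ ι ρ ρ' hρ _ h h'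
  exact ReciprocityUpToIrreducibility.isConjugate_of_satakeFrobCompatibleAt π.1 ι hρ h h'

end Summit.Langlands.Langlands.Theorems
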